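import Literature.NumberTheory.EllipticCurves.GrossPointsThetaElement
import Literature.NumberTheory.EllipticCurves.HeegnerPoints
import Literature.NumberTheory.EllipticCurves.GaloisAction
import Literature.NumberTheory.DiophantineGeometry.Conductor
import HarnessLib

/-!
# Theta elements of Gross points: named facts (existence of towers; norm-compatibility; `μ = 0`)

Fourth file of the definition item `defn-GrossPointsThetaElement`. The preceding files
(`GrossPoints`, `GrossPointsPicardAction`, `GrossPointsPicardActionHeegner`,
`GrossPointsThetaElement`) are definitions and proved API only; here we vendor, as named facts
(`def … : Prop`, D-0014) stated in that vocabulary, three published theorems the requesting BSD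
lines consume:

* `nonempty_grossPointTower` — Bertolini–Darmon 1996, Lemma 2.1–2.2 with §2.4 (Eichler's theory
  of optimal embeddings, Vignéras LNM 800 III.5.11–5.13): in the definite configuration (primes
  of `N⁺` split, primes of `N⁻` inert in the imaginary quadratic `K`, `N = N⁺N⁻` square-free,
  `p ∤ N D_K`) Gross points of every conductor `p^n` exist and fit into compatible towers.
* `grossPointTower_isNormCompatible` — Bertolini–Darmon 1996, Prop. 2.7 / Cor. 2.8 (with the
  norm relations of §2.4): the theta elements `θ_n` of a tower of Gross points are compatible
  under `ℤ_p[G_{n+1}] → ℤ_p[G_n]`, i.e. `θ_∞ ∈ ℤ_p⟦G_∞⟧` exists.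
* `vatsal_hasMuZeroAc` — Pollack–Weston 2011, Thm. 2.3 (1) (Vatsal 2003, Thm. 1.1): for `f = f_E`
  `p`-ordinary with `ρ̄_{E,p}` irreducible (squarefree level `N = N⁺N⁻` prime to `p D_K`, `N⁻`
  the product of the primes of `N` inert in `K`, with an odd number of factors), the
  anticyclotomic `p`-adic `L`-function `L_p(f, K) ∈ Λ` has `μ = 0`; in the finite-level form
  `GrossPointTower.HasMuZeroAc` of the previous file.

## Faithfulness notes

* BD96 Prop. 2.7 is stated for their points `z_n` built from ANY compatible system
  `P_n ∈ H_N(K; c p^n)` on `X_{N⁺,N⁻}` with `E` ordinary at `p` ("In all cases, the points `z_n`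
  are norm-compatible"); their standing hypotheses (§2.1–2.4: `K` imaginary quadratic with
  `(Disc K, N) = 1`, `N` square-free, `p ∤ c · Disc K`; here `c = 1`, and Case 1 `p ∤ N`) are kept.
  Only the `T_p`-eigenvector property of `φ` enters the proof (`⟨T_p P, v⟩ = ⟨P, T_p v⟩`), so the
  fact is stated for any `φ` with `T(p) φ = a φ` in the tree's convention
  (`Brandt.matrix S.O p *ᵥ φ = a • φ`, the action on divisor coordinate vectors, self-adjoint for
  Gross's pairing) and any unit root `α` of `x² - a x + p`.
* Pollack–Weston's `L_p(f, K)` (their §2.1, built from `ψ_f = ⟨·, g_f⟩` with `g_f` a generator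
  of `ℳ^f`, normalised by Lemma 2.1 so that `1 ∈ im ψ_f`) is the image in `Λ` of the family
  `(θ_n)` of the previous file with `φ = g_f` a primitive generator of the eigen-line (the tree's
  `Brandt.eigenLattice`, saturated) — up to a unit of `Λ` and the involution `σ ↦ σ⁻¹`, which do
  not change `μ`; `μ(Q) := max {c : Q ∈ 𝔭^c Λ}` (PW §2.3) vanishes iff the finite-level images
  are eventually not divisible by `p` (`⋂_n (p, ω_n) = p Λ`), which is `HasMuZeroAc`. PW fix an
  odd prime `p` (§1 Notation) and `f` of weight `2`, squarefree level `N` prime to `p D`, trivial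
  character, `N⁻` with an odd number of prime factors; for `f = f_E` (modularity) these read:
  `E` of squarefree conductor `N_E = N⁺N⁻` (`W.conductorNorm ℤ`), primes of `N⁺` split and of
  `N⁻` inert in `K` (then `N⁻` has an odd number of prime factors as soon as a setup of type
  `(N⁺, N⁻)` exists, which the statement presupposes by quantifying over `S`), `p ∤ N_E D_K` odd,
  `a_p(E) = W.LFunction p` a `p`-adic unit, `ρ̄_{E,p}` irreducible
  (`WeierstrassCurve.HasIrreducibleModPGaloisRep`).
* BD96 Lemma 2.1/2.2 ("the set `H_{M⁺,M⁻}(K; c pⁿ)` is non-empty if and only if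
  `(M⁺, M⁻) = (N⁺_*, N⁻_*)`", `N⁺ =` product of the primes of `N` split in `K`, `N⁻ =` product of
  the inert ones, for `N` square-free prime to `Disc K` and `p ∤ c Disc K`; Case `p ∤ N`:
  `N_* = N`) gives `H(K, pⁿ) ≠ ∅` for all `n ≥ 0` on `X_{N⁺,N⁻}`, for every Eichler order of
  level `N⁺` (the left orders `O_L(I)` exhaust its genus); compatible towers then exist level by
  level, since by §2.4 each point of conductor `pⁿ` is the lower neighbour `P̄` of each of its `p`
  (`n ≥ 1`) neighbours of conductor `pⁿ⁺¹`. The facts `grossPointTower_isNormCompatible` and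
  `vatsal_hasMuZeroAc` assert no existence; they are universally quantified over setups and
  towers.

## References

* [BertoliniDarmon1996] Bertolini–Darmon, Invent. Math. 126 (1996), §2.1–2.2 (Lemma 2.1,
  2.2), §2.4 (compatible systems, norm relations), §2.5 (5), Prop. 2.7, Cor. 2.8.
* [VignerasLNM800] M.-F. Vignéras, LNM 800, Ch. III §5, Thm. 5.11–Cor. 5.13 (optimal embeddings).
* [PollackWeston2011] Pollack–Weston, Compos. Math. 147 (2011), §1 Notation, §2.1, Lemma 2.1,
  §2.3 Thm. 2.3.
* [Vatsal2003] V. Vatsal, Duke Math. J. 116 (2003), Thm. 1.1.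
-/

noncomputable section

open scoped nonZeroDivisors Matrix
open NumberField Literature.NumberTheory.Automorphic

universe u

namespace Literature.NumberTheory.EllipticCurves

variable (K : Type u) [Field K] [NumberField K] {Nplus Nminus : ℕ}
  (S : Brandt.XiSetup Nplus Nminus) (p : ℕ) [Fact p.Prime]

/-- **Existence of towers of Gross points** (Bertolini–Darmon 1996, Lemma 2.1–2.2 and §2.4;
Eichler's optimal-embedding theory, Vignéras III.5.11–5.13): let `K` be an imaginary quadratic
field and `S` a Brandt setup of square-free level `N = N⁺N⁻` with `(N p, D_K) = 1`, `p ∤ N`, every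
prime of `N⁺` split and every prime of `N⁻` inert in `K` (BD96's Heegner condition of §2.2 for
the definite curve `X_{N⁺,N⁻}`). Then for every `n ≥ 0` there are Gross points of conductor
`pⁿ` ("`H_N(K; c pⁿ)` is non-empty", Lemma 2.2 with `c = 1`), and they can be chosen compatibly
along the Bruhat–Tits tree at `p` (§2.4: "Choose points `P_n ∈ H_N(K; c pⁿ)` which are
compatible"), i.e. a `GrossPointTower K S p` exists. [cite: BertoliniDarmon1996, Lemma 2.2 and §2.4] [cite: VignerasLNM800, Ch. III §5 Cor. 5.12] -/
def nonempty_grossPointTower : Prop :=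
  IsImaginaryQuadratic K → Squarefree (Nplus * Nminus) →
    (Nplus * Nminus * p).Coprime (NumberField.discr K).natAbs → ¬ p ∣ Nplus * Nminus →
    (∀ ℓ : ℕ, ℓ.Prime → ℓ ∣ Nplus → ((Ideal.span {(ℓ : ℤ)}).primesOver (𝓞 K)).ncard = 2) →
    (∀ ℓ : ℕ, ℓ.Prime → ℓ ∣ Nminus → ((Ideal.span {(ℓ : ℤ)}).primesOver (𝓞 K)).ncard = 1) →
    Nonempty (GrossPointTower K S p)

/-- **Norm-compatibility of the theta elements of Gross points** (Bertolini–Darmon 1996,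
Prop. 2.7 and Cor. 2.8, definite case, `c = 1`, `p ∤ N`): let `K` be an imaginary quadratic
field of discriminant prime to the square-free level `N = N⁺N⁻` of the Brandt setup `S` and to
`p ∤ N`; let `φ : Cls O → ℤ` be an eigenvector of the Brandt matrix `T(p)` with eigenvalue `a`
and `α ∈ ℤ_pˣ` a root of `x² - a x + p` (the ordinary case). Then for every tower
`(x_n)_n` of Gross points of conductor `p^n` the theta elements
`θ_{n+1} = Σ_σ z_{n+1}(σ) σ⁻¹ ∈ ℤ_p[Pic(𝒪_{p^{n+1}})]` built from
`z_{n+1} = α^{-(n+1)} y_{n+1} - α^{-(n+2)} y_n`, `y_n(σ) = ⟨σ x_n, φ⟩`, are compatible under the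
projections `ℤ_p[G_{n+2}] → ℤ_p[G_{n+1}]` ("the elements `θ_n` are compatible under the natural
projections"), i.e. `(θ_{n+1})_n ∈ ℤ_p⟦G_∞⟧`. The printed proof ("a direct calculation") rests on
the norm relations `Norm_{K_{n+1}/K_n} P_{n+1} = T_p P_n - P_{n-1}` (`n ≥ 1`) of §2.4. [cite: BertoliniDarmon1996, Prop. 2.7 and §2.7] -/
def grossPointTower_isNormCompatible : Prop :=
  ∀ [Fintype (Brandt.ClassSet S.O)], IsImaginaryQuadratic K →
    Squarefree (Nplus * Nminus) → (Nplus * Nminus * p).Coprime (NumberField.discr K).natAbs →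
    ¬ p ∣ Nplus * Nminus →
    ∀ (φ : Brandt.ClassSet S.O → ℤ) (a : ℤ), Brandt.matrix S.O p *ᵥ φ = a • φ →
    ∀ (α : ℤ_[p]ˣ), (α : ℤ_[p]) ^ 2 - a * α + p = 0 →
    ∀ T : GrossPointTower K S p, T.IsNormCompatible p φ α

/-- **Vatsal's theorem `μ(L_p(f, K)) = 0`** in the form of Pollack–Weston 2011, Thm. 2.3 (1)
("Assume that the residual Galois representation `ρ̄_f` attached to `f` is irreducible. Then
`μ(L_p(f, K)) = 0`"), for `f = f_E`: let `p` be an odd prime, `K` an imaginary quadratic field,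
`E/ℚ` (model `W`) an elliptic curve of square-free conductor `N_E = N⁺N⁻` with `p ∤ N_E D_K`,
`(N_E, D_K) = 1`, every prime of `N⁺` split and every prime of `N⁻` inert in `K`, `S` a Brandt
setup of type `(N⁺, N⁻)` (so `N⁻` has an odd number of prime factors), `a_p(E) ∈ ℤ_pˣ`
(`p`-ordinary) and `ρ̄_{E,p}` irreducible; let `φ` be a primitive generator of the
`a(E)`-eigen-line of the Brandt module (Pollack–Weston's `g_f`, `ψ_f = ⟨·, g_f⟩`, §2.1). Then
for every tower of Gross points the anticyclotomic theta elements `θ_n^{ac}` (images of `θ_n`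
in `ℤ_p[G_n / Δ]`, whose limit is Pollack–Weston's `L_p(f, K) ∈ Λ` up to `Λˣ` and `σ ↦ σ⁻¹`)
are eventually not divisible by `p`: `μ = 0` for `μ(Q) = max {c : Q ∈ p^c Λ}` (§2.3).
Originally Vatsal, Duke Math. J. 116 (2003), Thm. 1.1. [cite: PollackWeston2011, Thm. 2.3] [cite: Vatsal2003, Thm. 1.1] -/
def vatsal_hasMuZeroAc (W : WeierstrassCurve ℚ) : Prop :=
  ∀ [W.IsElliptic] [Fintype (Brandt.ClassSet S.O)], IsImaginaryQuadratic K → p ≠ 2 →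
    Nplus * Nminus = W.conductorNorm ℤ → Squarefree (Nplus * Nminus) →
    (Nplus * Nminus * p).Coprime (NumberField.discr K).natAbs → ¬ p ∣ Nplus * Nminus →
    (∀ ℓ : ℕ, ℓ.Prime → ℓ ∣ Nplus → ((Ideal.span {(ℓ : ℤ)}).primesOver (𝓞 K)).ncard = 2) →
    (∀ ℓ : ℕ, ℓ.Prime → ℓ ∣ Nminus → ((Ideal.span {(ℓ : ℤ)}).primesOver (𝓞 K)).ncard = 1) →
    ¬ (p : ℤ) ∣ W.LFunction p → W.HasIrreducibleModPGaloisRep p →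
    ∀ (φ : Brandt.ClassSet S.O → ℤ), φ ≠ 0 →
      Brandt.eigenLattice (Nplus * Nminus) (Brandt.matrix S.O) (fun n => W.LFunction n) = ℤ ∙ φ →
    ∀ T : GrossPointTower K S p, T.HasMuZeroAc p φ (padicUnitRoot p (W.LFunction p))

end Literature.NumberTheory.EllipticCurves

end
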